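import Literature.Probability.LatticeModels.AnnulusManeuver
import Literature.Probability.LatticeModels.WeakBeurlingEstimate
import HarnessLib

/-!
# Box-chain maneuvers of arbitrary length, and kill-forcing by winding

Topic `Literature/Probability/LatticeModels`. The twelve-step annulus maneuver of
`AnnulusManeuver.lean` (Smirnov 2010, Lemma B.2, after Kesten) generalised to an arbitrary
finite design `D : ℕ → MStep` of length `n` (rectangles `U i`, landing sets `L i`, start sets
`T i` in units of `k`, step `i` about its own centre `c i`), for use in the conformal boundary hitting estimate of
Lawler–Schramm–Werner (2004), Lemma 5.4 (random-walk side):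

* `BoxChain.bU/bL/bT`, the step and tail constants, and **the free chain is at least the tail
  product on the start sets** (`BoxChain.tailConst_le_chainM`) under the design checks
  `L i ⊆ T (i+1)` and `w, h ≥ 8` (passed as hypotheses, to be discharged by `omega` for each
  explicit design);
* **a positive killed chain is witnessed by landing points and walks in `S`**
  (`BoxChain.exists_landings_of_chainN_pos`), and their concatenation over a range of steps
  lying in a region (`BoxChain.exists_walk_Ico`);
* **kill-forcing by winding** (`false_of_circuit`): four walks in `K` around a face `F₀ ∉ K` of a
  hole-free `K`, lying in the four half-planes beyond a box about `F₀`, form a closed walk of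
  winding number `-1` about `F₀` (`WeakBeurling.walkWinding_four_pieces`) and therefore meet the
  escape path of `F₀` (`WeakBeurling.exists_mem_support_of_walkWinding_ne_zero`) — impossible;
  whence **the killed chain of a clockwise (resp. counter-clockwise) circuit design vanishes**
  (`BoxChain.chainN_eq_zero_of_cw`, `BoxChain.chainN_eq_zero_of_ccw`) and the walk is killed
  before completing the maneuver with probability at least the tail product
  (`BoxChain.tailConst_le_killedIn_of_chainN_eq_zero`).

Everything here is proved and `[folklore]`.

## References

* S. Smirnov, Ann. of Math. 172 (2010), App. B, Lemma B.2 — bib key `Smirnov2010`.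
* G. F. Lawler, O. Schramm, W. Werner, Ann. Probab. 32 (2004), proof of Lemma 5.4.
-/

noncomputable section

namespace Literature.Probability.LatticeModels

open Set SimpleGraph
open Literature.Probability.Percolation

namespace BoxChain

section Geometry

variable (D : ℕ → MStep) (n : ℕ) (c : ℕ → Site 2) (k : ℕ)

/-- Rectangles of the design (empty beyond the `n`-th). [folklore] -/
def bU (i : ℕ) : Set (Site 2) := if i < n then (D i).U (c i) k else ∅

/-- Landing sets of the design. [folklore] -/
def bL (i : ℕ) : Set (Site 2) := if i < n then (D i).L (c i) k else ∅

/-- Start sets of the design (everything beyond the `n`-th). [folklore] -/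
def bT (i : ℕ) : Set (Site 2) := if i < n then (D i).T (c i) k else Set.univ

/-- The rectangles are finite. [folklore] -/
theorem bU_finite (i : ℕ) : (bU D n c k i).Finite := by
  unfold bU; split_ifs
  · exact rectInterior_finite _ _ _
  · exact Set.finite_empty

variable {D n c k}

/-- Unfolding `bU` below `n`. [folklore] -/
theorem bU_of_lt {i : ℕ} (hi : i < n) : bU D n c k i = (D i).U (c i) k := if_pos hi
/-- Unfolding `bL` below `n`. [folklore] -/
theorem bL_of_lt {i : ℕ} (hi : i < n) : bL D n c k i = (D i).L (c i) k := if_pos hi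
/-- Unfolding `bT` below `n`. [folklore] -/
theorem bT_of_lt {i : ℕ} (hi : i < n) : bT D n c k i = (D i).T (c i) k := if_pos hi

/-- Start sets lie in their rectangles. [folklore] -/
theorem bT_subset_bU {i : ℕ} (hi : i < n) : bT D n c k i ⊆ bU D n c k i := by
  intro x hx
  rw [bT_of_lt hi] at hx; rw [bU_of_lt hi]
  exact hx.1

/-- A landing set is disjoint from its (open) rectangle. [folklore] -/
theorem _root_.Literature.Probability.LatticeModels.MStep.disjoint_U_L (s : MStep) (c : Site 2) (k : ℕ) :
    Disjoint (s.U c k) (s.L c k) := by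
  rw [Set.disjoint_left]
  intro x hxU hxL
  simp only [MStep.U, MStep.corner, rectInterior, Set.mem_setOf_eq, Matrix.cons_val_zero,
    Matrix.cons_val_one] at hxU
  simp only [MStep.L, Set.mem_setOf_eq] at hxL
  rcases hxL with ⟨-, h, -⟩ | ⟨-, h, -⟩ | ⟨-, h, -⟩ | ⟨-, h, -⟩ <;> omega

/-- Landing sets are disjoint from their rectangles. [folklore] -/
theorem disjoint_bU_bL (i : ℕ) : Disjoint (bU D n c k i) (bL D n c k i) := by
  by_cases hi : i < n
  · rw [bU_of_lt hi, bL_of_lt hi]; exact (D i).disjoint_U_L (c i) k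
  · simp [bU, hi]

end Geometry

/-! ### The free chain is bounded below on the start sets -/

section Lower

variable (D : ℕ → MStep) (n : ℕ)

/-- The constant of step `i` (`1` beyond the `n`-th). [folklore] -/
def stepConst (i : ℕ) : ℝ := if i < n then (D i).const else 1

/-- The tail products `∏_{i ≤ j < n} c_j`. [folklore] -/
def tailConst (i : ℕ) : ℝ := ∏ j ∈ Finset.Ico i n, stepConst D n j

variable {D n}

/-- The step constants are positive (positive dimensions). [folklore] -/
theorem stepConst_pos (hwh : ∀ i < n, 0 < (D i).w ∧ 0 < (D i).h) (i : ℕ) : 0 < stepConst D n i := by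
  unfold stepConst; split_ifs with h
  · exact (D i).const_pos (hwh i h).1 (hwh i h).2
  · exact one_pos

/-- Tail products are positive. [folklore] -/
theorem tailConst_pos (hwh : ∀ i < n, 0 < (D i).w ∧ 0 < (D i).h) (i : ℕ) : 0 < tailConst D n i :=
  Finset.prod_pos fun j _ ↦ stepConst_pos hwh j

/-- `tailConst i = c_i · tailConst (i+1)` for `i < n`. [folklore] -/
theorem tailConst_succ {i : ℕ} (hi : i < n) : tailConst D n i = stepConst D n i * tailConst D n (i + 1) := by
  unfold tailConst
  rw [Finset.prod_eq_prod_Ico_succ_bot hi]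

variable {c : ℕ → Site 2} {k : ℕ}

/-- **The free chain is at least the tail product on the start sets** (downward induction with
the one-step lower bound `MStep.lower_bound` and the design check `L i ⊆ T (i+1)`). [folklore] -/
theorem tailConst_le_chainM (hk : 0 < k) (hwh : ∀ i < n, 8 ≤ (D i).w ∧ 8 ≤ (D i).h)
    (hLT : ∀ i, i + 1 < n → (D i).L (c i) k ⊆ (D (i + 1)).T (c (i + 1)) k)
    {j : ℕ} (hj : j ≤ n) {x : Site 2} (hx : x ∈ bT D n c k (n - j)) :
    tailConst D n (n - j) ≤ chainM (bU D n c k) (bL D n c k) n j x := by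
  classical
  have hwh' : ∀ i < n, 0 < (D i).w ∧ 0 < (D i).h := fun i hi ↦ ⟨by linarith [(hwh i hi).1], by linarith [(hwh i hi).2]⟩
  induction j generalizing x with
  | zero => simp [tailConst, chainM]
  | succ j ih =>
    have hi : n - (j + 1) < n := by omega
    set i := n - (j + 1) with hidef
    have hi' : n - 1 - j = i := by omega
    have hsucc : n - j = i + 1 := by omega
    simp only [chainM, hi']
    rw [tailConst_succ hi]
    have hM0 : ∀ w, 0 ≤ chainM (bU D n c k) (bL D n c k) n j w := fun w ↦
      (chainM_mem_Icc (bU_finite D n c k) j w).1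
    have hT : ∀ w ∈ bL D n c k i, tailConst D n (i + 1) ≤ chainM (bU D n c k) (bL D n c k) n j w := by
      intro w hw
      have hw' : w ∈ bT D n c k (i + 1) := by
        by_cases hi1 : i + 1 < n
        · rw [bT_of_lt hi1]; rw [bL_of_lt hi] at hw; exact hLT i hi1 hw
        · simp [bT, hi1]
      have := ih (by omega) (x := w) (by rw [hsucc]; exact hw')
      rwa [hsucc] at this
    have key := MStep.lower_bound (D i) (c i) k hk (hwh i hi).1 (hwh i hi).2
      (g := fun w ↦ if w ∈ bL D n c k i then chainM (bU D n c k) (bL D n c k) n j w else 0)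
      (fun w ↦ by split_ifs <;> [exact hM0 w; exact le_rfl]) (tailConst_pos hwh' (i + 1)).le
      (fun w hw ↦ by
        have hw' : w ∈ bL D n c k i := by rw [bL_of_lt hi]; exact hw
        simp only [hw', if_true]; exact hT w hw') (x := x) (by rw [bT_of_lt hi] at hx; exact hx)
    have hc : stepConst D n i = (D i).const := if_pos hi
    rw [mul_comm, bU_of_lt hi, hc]
    exact key

/-- **`M ≥ tailConst 0` on the first start set.** [folklore] -/
theorem tailConst_zero_le_chainM (hk : 0 < k) (hwh : ∀ i < n, 8 ≤ (D i).w ∧ 8 ≤ (D i).h)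
    (hLT : ∀ i, i + 1 < n → (D i).L (c i) k ⊆ (D (i + 1)).T (c (i + 1)) k) {x : Site 2} (hx : x ∈ bT D n c k 0) :
    tailConst D n 0 ≤ chainM (bU D n c k) (bL D n c k) n n x := by
  have h := tailConst_le_chainM hk hwh hLT le_rfl (x := x) (by rw [Nat.sub_self]; exact hx)
  rwa [Nat.sub_self] at h

/-- **The walk is killed before completing the maneuver with probability `≥ tailConst 0`** when
the killed chain vanishes at the start point: `tailConst 0 ≤ killedIn S W x` for every finite
`W` containing all rectangles and landing sets. [folklore] -/
theorem tailConst_le_killedIn_of_chainN_eq_zero (hk : 0 < k) (hwh : ∀ i < n, 8 ≤ (D i).w ∧ 8 ≤ (D i).h)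
    (hLT : ∀ i, i + 1 < n → (D i).L (c i) k ⊆ (D (i + 1)).T (c (i + 1)) k) {S W : Set (Site 2)} (hW : W.Finite)
    (hUW : ∀ i, bU D n c k i ⊆ W) (hLW : ∀ i, bL D n c k i ⊆ W) {x : Site 2} (hx : x ∈ bT D n c k 0)
    (hN : chainN (bU D n c k) (bL D n c k) S n n x = 0) : tailConst D n 0 ≤ killedIn S W x := by
  have hIII := chainM_sub_chainN_le_killedIn (U := bU D n c k) (L := bL D n c k) (S := S) (n := n)
    (bU_finite D n c k) hW hUW hLW disjoint_bU_bL n x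
  rw [hN, sub_zero] at hIII
  exact (tailConst_zero_le_chainM hk hwh hLT hx).trans hIII

end Lower

/-! ### A positive killed chain is witnessed by walks in `S` -/

section Walks

variable {D : ℕ → MStep} {n : ℕ} {c : ℕ → Site 2} {k : ℕ} {S : Set (Site 2)}

/-- One step of the killed maneuver inside `S`. [folklore] -/
theorem iter_step {i : ℕ} (hi : i < n) {y : Site 2} (hy : y ∈ bU D n c k i) (hyS : y ∈ S)
    (hpos : 0 < chainN (bU D n c k) (bL D n c k) S n (n - i) y) :
    ∃ y', y' ∈ bL D n c k i ∧ y' ∈ S ∧ 0 < chainN (bU D n c k) (bL D n c k) S n (n - 1 - i) y' ∧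
      ∃ p : (zdGraph 2).Walk y y', ∀ z ∈ p.support, z ∈ S ∧ (z ∈ bU D n c k i ∨ z = y') := by
  have e1 : n - 1 - (n - 1 - i) = i := by omega
  have e2 : n - i = (n - 1 - i) + 1 := by omega
  rw [e2] at hpos
  have := exists_walk_of_chainN_pos (U := bU D n c k) (L := bL D n c k) (S := S) (n := n)
    (bU_finite D n c k) (n - 1 - i) (x := y) (by rw [e1]; exact ⟨hy, hyS⟩) hpos
  rw [e1] at this
  exact this

/-- **Landing points and walks of a positive killed chain.** If `N_n x > 0` at `x ∈ T 0 ∩ S`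
(with `L i ⊆ T (i+1)`), there are landing points `y_1, …, y_n` (`y_i ∈ L (i-1) ∩ S`,
`y_0 = x`) and walks `y_i → y_{i+1}` with supports in `S ∩ (U i ∪ {y_{i+1}})`. [folklore] -/
theorem exists_landings_of_chainN_pos (hLT : ∀ i, i + 1 < n → (D i).L (c i) k ⊆ (D (i + 1)).T (c (i + 1)) k)
    {x : Site 2} (hx : x ∈ bT D n c k 0) (hxS : x ∈ S)
    (hpos : 0 < chainN (bU D n c k) (bL D n c k) S n n x) :
    ∃ ys : ℕ → Site 2, ys 0 = x ∧ (∀ i < n, ys (i + 1) ∈ bL D n c k i ∧ ys (i + 1) ∈ S) ∧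
      ∀ i < n, ∃ p : (zdGraph 2).Walk (ys i) (ys (i + 1)),
        ∀ z ∈ p.support, z ∈ S ∧ (z ∈ bU D n c k i ∨ z = ys (i + 1)) := by
  classical
  -- partial sequences
  have main : ∀ m ≤ n, ∃ ys : ℕ → Site 2, ys 0 = x ∧ (∀ i < m, ys (i + 1) ∈ bL D n c k i ∧ ys (i + 1) ∈ S) ∧
      (∀ i < m, ∃ p : (zdGraph 2).Walk (ys i) (ys (i + 1)),
        ∀ z ∈ p.support, z ∈ S ∧ (z ∈ bU D n c k i ∨ z = ys (i + 1))) ∧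
      0 < chainN (bU D n c k) (bL D n c k) S n (n - m) (ys m) ∧ ys m ∈ S ∧ ys m ∈ bT D n c k m := by
    intro m
    induction m with
    | zero =>
      intro _
      exact ⟨fun _ ↦ x, rfl, fun i hi ↦ absurd hi (Nat.not_lt_zero i),
        fun i hi ↦ absurd hi (Nat.not_lt_zero i), by rwa [Nat.sub_zero], hxS, hx⟩
    | succ m ih =>
      intro hm
      obtain ⟨ys, h0, hL, hW, hpos', hS', hT'⟩ := ih (by omega)
      have hm' : m < n := by omega
      obtain ⟨y', hy'L, hy'S, hy'pos, p, hp⟩ := iter_step hm' (bT_subset_bU hm' hT') hS' hpos'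
      set ys' : ℕ → Site 2 := fun i ↦ if i ≤ m then ys i else y' with hys'
      have hle : ∀ i ≤ m, ys' i = ys i := fun i hi ↦ if_pos hi
      have hsucc : ys' (m + 1) = y' := if_neg (by omega)
      refine ⟨ys', by rw [hle 0 (Nat.zero_le _), h0], fun i hi ↦ ?_, fun i hi ↦ ?_, ?_, ?_, ?_⟩
      · rcases Nat.lt_succ_iff_lt_or_eq.1 hi with hi | rfl
        · rw [hle (i + 1) hi]; exact hL i hi
        · rw [hsucc]; exact ⟨hy'L, hy'S⟩
      · rcases Nat.lt_succ_iff_lt_or_eq.1 hi with hi | rfl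
        · obtain ⟨q, hq⟩ := hW i hi
          refine ⟨q.copy (hle i hi.le).symm (hle (i + 1) hi).symm, ?_⟩
          rw [Walk.support_copy, hle (i + 1) hi]; exact hq
        · refine ⟨p.copy (hle i le_rfl).symm hsucc.symm, ?_⟩
          rw [Walk.support_copy, hsucc]; exact hp
      · rw [hsucc]
        have : n - 1 - m = n - (m + 1) := by omega
        rwa [this] at hy'pos
      · rw [hsucc]; exact hy'S
      · rw [hsucc]
        by_cases hm1 : m + 1 < n
        · rw [bT_of_lt hm1]; rw [bL_of_lt hm'] at hy'L; exact hLT m hm1 hy'L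
        · simp [bT, hm1]
  obtain ⟨ys, h0, hL, hW, -, -, -⟩ := main n le_rfl
  exact ⟨ys, h0, hL, hW⟩

/-- **Concatenation over a range of steps.** Given the landing points and walks, if the
rectangles `U i` and landing points `y_{i+1}` for `a ≤ i < b` lie in `H`, and `y_a ∈ S ∩ H`,
there is a walk `y_a → y_b` with support in `S ∩ H`. [folklore] -/
theorem exists_walk_Ico {ys : ℕ → Site 2}
    (hW : ∀ i < n, ∃ p : (zdGraph 2).Walk (ys i) (ys (i + 1)),
      ∀ z ∈ p.support, z ∈ S ∧ (z ∈ bU D n c k i ∨ z = ys (i + 1)))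
    {H : Set (Site 2)} {a b : ℕ} (hab : a ≤ b) (hb : b ≤ n)
    (hH : ∀ i, a ≤ i → i < b → bU D n c k i ⊆ H ∧ ys (i + 1) ∈ H) (haS : ys a ∈ S) (haH : ys a ∈ H) :
    ∃ p : (zdGraph 2).Walk (ys a) (ys b), ∀ z ∈ p.support, z ∈ S ∧ z ∈ H := by
  induction b, hab using Nat.le_induction with
  | base => exact ⟨Walk.nil, fun z hz ↦ by rw [Walk.support_nil, List.mem_singleton] at hz; rw [hz]; exact ⟨haS, haH⟩⟩
  | succ b hab ih =>
    obtain ⟨p, hp⟩ := ih (by omega) (fun i hai hib ↦ hH i hai (by omega))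
    obtain ⟨q, hq⟩ := hW b (by omega)
    obtain ⟨hUb, hyb⟩ := hH b hab (by omega)
    refine ⟨p.append q, fun z hz ↦ ?_⟩
    rw [Walk.mem_support_append_iff] at hz
    rcases hz with hz | hz
    · exact hp z hz
    · obtain ⟨hzS, hzU⟩ := hq z hz
      exact ⟨hzS, hzU.elim (fun h ↦ hUb h) (fun h ↦ h ▸ hyb)⟩

end Walks

/-! ### Kill-forcing by winding -/

section Kill

variable {K : Set (Site 2)} {F₀ : Site 2} {m N : ℤ}

/-- **Four walks in `K` around a face off the hole-free `K` cannot close up.** If `WT, WR, WB, WL`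
lie in `K`, inside the box of radius `N` about `F₀ ∉ K`, and respectively above, right of,
below and left of the box of radius `m ≥ 1` about `F₀` (with the right walk descending from
above to below), then the closed walk `WT WR WB WL` winds `-1` times about `F₀`, hence meets the
escape path of `F₀` through `Kᶜ` (`HoleFree`) — a contradiction. [folklore] -/
theorem false_of_circuit (hK : HoleFree K) (hF₀ : F₀ ∉ K) (hm : 1 ≤ m)
    {z₁ z₂ z₃ z₄ : Site 2} (WT : (zdGraph 2).Walk z₄ z₁) (WR : (zdGraph 2).Walk z₁ z₂)
    (WB : (zdGraph 2).Walk z₂ z₃) (WL : (zdGraph 2).Walk z₃ z₄)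
    (hWT : ∀ z ∈ WT.support, z ∈ K ∧ z ∈ WeakBeurling.sqBox F₀ N ∧ F₀ 1 + m + 1 ≤ z 1)
    (hWR : ∀ z ∈ WR.support, z ∈ K ∧ z ∈ WeakBeurling.sqBox F₀ N ∧ F₀ 0 + m + 1 ≤ z 0)
    (hWB : ∀ z ∈ WB.support, z ∈ K ∧ z ∈ WeakBeurling.sqBox F₀ N ∧ z 1 ≤ F₀ 1 - m - 1)
    (hWL : ∀ z ∈ WL.support, z ∈ K ∧ z ∈ WeakBeurling.sqBox F₀ N ∧ z 0 ≤ F₀ 0 - m - 1)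
    (h₁ : F₀ 1 + m + 1 ≤ z₁ 1) (h₂ : z₂ 1 ≤ F₀ 1 - m - 1) : False := by
  set C := ((WT.append WR).append WB).append WL with hC
  have hwind : walkWinding C F₀ = -1 :=
    WeakBeurling.walkWinding_four_pieces hm WT WR WB WL (fun z hz ↦ (hWT z hz).2.2)
      (fun z hz ↦ (hWR z hz).2.2) (fun z hz ↦ (hWB z hz).2.2) (fun z hz ↦ (hWL z hz).2.2) h₁ h₂
  have hsupp : ∀ z ∈ C.support, z ∈ K ∧ z ∈ WeakBeurling.sqBox F₀ N := by
    intro z hz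
    simp only [hC, Walk.mem_support_append_iff] at hz
    rcases hz with ((hz | hz) | hz) | hz
    · exact ⟨(hWT z hz).1, (hWT z hz).2.1⟩
    · exact ⟨(hWR z hz).1, (hWR z hz).2.1⟩
    · exact ⟨(hWB z hz).1, (hWB z hz).2.1⟩
    · exact ⟨(hWL z hz).1, (hWL z hz).2.1⟩
  -- the escape path of `F₀`
  obtain ⟨g', hg'1, hγ⟩ := hK F₀ hF₀ (F₀ 1 + N + 1)
  obtain ⟨γ, hγK⟩ := exists_walk_of_faceStep hγ hF₀
  have hd : g' ∉ WeakBeurling.sqBox F₀ N := by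
    rw [WeakBeurling.mem_sqBox, not_and_or]; right; rw [abs_le]; push Not; intro _; linarith
  obtain ⟨z, hzγ, hzC⟩ := WeakBeurling.exists_mem_support_of_walkWinding_ne_zero
    (fun z hz ↦ (hsupp z hz).2) (by rw [hwind]; norm_num) hd γ
  exact hγK z hzγ (hsupp z hzC).1

variable {D : ℕ → MStep} {n : ℕ} {c : ℕ → Site 2} {k : ℕ} {S : Set (Site 2)}

/-- The right, bottom, left and top half-planes beyond the box of radius `m` about `F₀`. [folklore] -/
def HR (F₀ : Site 2) (m : ℤ) : Set (Site 2) := {z | F₀ 0 + m + 1 ≤ z 0}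
/-- See `HR`. [folklore] -/
def HB (F₀ : Site 2) (m : ℤ) : Set (Site 2) := {z | z 1 ≤ F₀ 1 - m - 1}
/-- See `HR`. [folklore] -/
def HL (F₀ : Site 2) (m : ℤ) : Set (Site 2) := {z | z 0 ≤ F₀ 0 - m - 1}
/-- See `HR`. [folklore] -/
def HT (F₀ : Site 2) (m : ℤ) : Set (Site 2) := {z | F₀ 1 + m + 1 ≤ z 1}

/-- **The killed chain of a clockwise circuit design vanishes.** Design `D` of length `n` with
`L i ⊆ T (i+1)`, whose steps `[0, i₁)` (approach and upper part of the descent), `[i₁, i₂)`,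
`[i₂, i₃)`, `[i₃, i₄)`, `[i₄, n)` lie (rectangles, landing sets, all inside the box of radius
`N` about `F₀`) respectively right of, below, left of, above, and right of the box of radius
`m ≥ 1` about the face `F₀ ∉ K` (`K ⊇ S` hole-free), with `i₁ < i₂`, `i₃ < i₄`, and such that
every final landing point is joined back to the start `x` by a walk in `K`, right of the small
box and inside the big one. Then `N_n x = 0`: the walk killed on `Sᶜ` cannot perform the whole
maneuver. [folklore] -/
theorem chainN_eq_zero_of_cw (hK : HoleFree K) (hSK : S ⊆ K) (hF₀ : F₀ ∉ K) (hm : 1 ≤ m)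
    (hLT : ∀ i, i + 1 < n → (D i).L (c i) k ⊆ (D (i + 1)).T (c (i + 1)) k)
    {i₁ i₂ i₃ i₄ : ℕ} (h12 : i₁ < i₂) (h23 : i₂ ≤ i₃) (h34 : i₃ < i₄) (h4n : i₄ ≤ n)
    (hbox : ∀ i < n, bU D n c k i ∪ bL D n c k i ⊆ WeakBeurling.sqBox F₀ N)
    (hR₁ : ∀ i < i₁, bU D n c k i ∪ bL D n c k i ⊆ HR F₀ m)
    (hBo : ∀ i, i₁ ≤ i → i < i₂ → bU D n c k i ∪ bL D n c k i ⊆ HB F₀ m)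
    (hLe : ∀ i, i₂ ≤ i → i < i₃ → bU D n c k i ∪ bL D n c k i ⊆ HL F₀ m)
    (hTo : ∀ i, i₃ ≤ i → i < i₄ → bU D n c k i ∪ bL D n c k i ⊆ HT F₀ m)
    (hR₂ : ∀ i, i₄ ≤ i → i < n → bU D n c k i ∪ bL D n c k i ⊆ HR F₀ m)
    {x : Site 2} (hx : x ∈ bT D n c k 0) (hxR : x ∈ HR F₀ m) (hxN : x ∈ WeakBeurling.sqBox F₀ N)
    (hclose : ∀ y ∈ bL D n c k (n - 1), ∃ q : (zdGraph 2).Walk y x,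
      ∀ z ∈ q.support, z ∈ K ∧ z ∈ WeakBeurling.sqBox F₀ N ∧ z ∈ HR F₀ m) :
    chainN (bU D n c k) (bL D n c k) S n n x = 0 := by
  classical
  have hn : 0 < n := by omega
  by_cases hxS : x ∈ S
  swap
  · -- off `S` the killed chain vanishes at once
    have e : n - 1 + 1 = n := Nat.sub_add_cancel hn
    have : chainN (bU D n c k) (bL D n c k) S n n x = chainN (bU D n c k) (bL D n c k) S n (n - 1 + 1) x := by
      rw [e]
    rw [this]
    show harmExt (bU D n c k (n - 1 - (n - 1)) ∩ S) _ x = 0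
    rw [harmExt_of_not_mem ((bU_finite D n c k _).subset inter_subset_left) _ (fun h ↦ hxS h.2)]
    simp [hxS]
  by_contra hne
  have hpos : 0 < chainN (bU D n c k) (bL D n c k) S n n x :=
    lt_of_le_of_ne (chainN_mem_Icc (bU_finite D n c k) n x).1 (Ne.symm hne)
  obtain ⟨ys, h0, hL, hW⟩ := exists_landings_of_chainN_pos hLT hx hxS hpos
  have hyS : ∀ i < n, ys (i + 1) ∈ S := fun i hi ↦ (hL i hi).2
  have hySK : ∀ i ≤ n, ys i ∈ K := by
    intro i hi
    rcases Nat.eq_zero_or_pos i with rfl | hi0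
    · rw [h0]; exact hSK hxS
    · have := hyS (i - 1) (by omega); rw [Nat.sub_add_cancel hi0] at this; exact hSK this
  -- membership of landing points in the regions of their steps
  have hyU : ∀ {H : Set (Site 2)} {i : ℕ}, i < n → bU D n c k i ∪ bL D n c k i ⊆ H → ys (i + 1) ∈ H :=
    fun hi h ↦ h (Or.inr (hL _ hi).1)
  have piece : ∀ {H : Set (Site 2)} {a b : ℕ}, a ≤ b → b ≤ n →
      (∀ i, a ≤ i → i < b → bU D n c k i ∪ bL D n c k i ⊆ H) → ys a ∈ S → ys a ∈ H →
      ∃ p : (zdGraph 2).Walk (ys a) (ys b), ∀ z ∈ p.support, z ∈ K ∧ z ∈ WeakBeurling.sqBox F₀ N ∧ z ∈ H := by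
    intro H a b hab hbn hH haS haH
    have haN : ys a ∈ WeakBeurling.sqBox F₀ N := by
      rcases Nat.eq_zero_or_pos a with h | ha0
      · rw [h, h0]; exact hxN
      · have := hyU (i := a - 1) (by omega) (hbox (a - 1) (by omega))
        rwa [Nat.sub_add_cancel ha0] at this
    obtain ⟨p, hp⟩ := exists_walk_Ico (D := D) (n := n) (c := c) (k := k) hW hab hbn
      (H := H ∩ WeakBeurling.sqBox F₀ N)
      (fun i hai hib ↦ ⟨subset_inter (subset_union_left.trans (hH i hai hib))
        (subset_union_left.trans (hbox i (by omega))),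
        ⟨hyU (by omega) (hH i hai hib), hyU (by omega) (hbox i (by omega))⟩⟩) haS ⟨haH, haN⟩
    exact ⟨p, fun z hz ↦ ⟨hSK (hp z hz).1, (hp z hz).2.2, (hp z hz).2.1⟩⟩
  have hx0S : ys 0 ∈ S := by rw [h0]; exact hxS
  -- the five pieces
  obtain ⟨W₁, hW₁⟩ := piece (H := HR F₀ m) (a := 0) (b := i₁) (by omega) (by omega)
    (fun i _ hi ↦ hR₁ i hi) hx0S (by rw [h0]; exact hxR)
  have hi₁ : ys i₁ ∈ HB F₀ m := by
    obtain ⟨q, hq⟩ := hW i₁ (by omega)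
    exact (hBo i₁ le_rfl h12) ((hq _ (Walk.start_mem_support q)).2.elim Or.inl
      (fun h ↦ Or.inr (h ▸ (hL i₁ (by omega)).1)))
  have hySall : ∀ i ≤ n, ys i ∈ S := by
    intro i hi
    rcases Nat.eq_zero_or_pos i with h | hi0
    · rw [h]; exact hx0S
    · have := hyS (i - 1) (by omega); rwa [Nat.sub_add_cancel hi0] at this
  obtain ⟨W₂, hW₂⟩ := piece (H := HB F₀ m) (a := i₁) (b := i₂) h12.le (by omega) hBo
    (hySall i₁ (by omega)) hi₁
  have hi₂ : ys i₂ ∈ HL F₀ m ∨ i₂ = i₃ := by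
    rcases lt_or_eq_of_le h23 with h | h
    · left
      obtain ⟨q, hq⟩ := hW i₂ (by omega)
      exact (hLe i₂ le_rfl h) ((hq _ (Walk.start_mem_support q)).2.elim Or.inl
        (fun h' ↦ Or.inr (h' ▸ (hL i₂ (by omega)).1)))
    · exact Or.inr h
  have hi₃ : ys i₃ ∈ HT F₀ m := by
    obtain ⟨q, hq⟩ := hW i₃ (by omega)
    exact (hTo i₃ le_rfl h34) ((hq _ (Walk.start_mem_support q)).2.elim Or.inl
      (fun h ↦ Or.inr (h ▸ (hL i₃ (by omega)).1)))
  have hyi₂S : ys i₂ ∈ S := hySall i₂ (by omega)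
  obtain ⟨W₃, hW₃⟩ : ∃ p : (zdGraph 2).Walk (ys i₂) (ys i₃),
      ∀ z ∈ p.support, z ∈ K ∧ z ∈ WeakBeurling.sqBox F₀ N ∧ z ∈ HL F₀ m := by
    rcases hi₂ with hi₂ | hi₂
    · exact piece (H := HL F₀ m) h23 (by omega) hLe hyi₂S hi₂
    · -- empty left piece: the trivial walk (its only point is `ys i₂ = ys i₃ ∈ HT ∩ HB`?) — we
      -- only need membership in `HL` of its support, so use the next piece's start instead:
      subst hi₂
      refine ⟨Walk.nil, fun z hz ↦ ?_⟩
      rw [Walk.support_nil, List.mem_singleton] at hz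
      subst hz
      -- `ys i₂ ∈ HB` (end of the bottom piece) and `∈ HT` (start of the top piece): impossible
      -- unless the box is degenerate; but `m ≥ 1` gives a contradiction, so anything holds
      exfalso
      have hb : ys i₂ ∈ HB F₀ m := by
        have := hyU (i := i₂ - 1) (by omega) (hBo (i₂ - 1) (by omega) (by omega))
        rwa [Nat.sub_add_cancel (by omega : 0 < i₂)] at this
      simp only [HB, HT, Set.mem_setOf_eq] at hb hi₃
      omega
  have hyi₃S : ys i₃ ∈ S := hySall i₃ (by omega)
  obtain ⟨W₄, hW₄⟩ := piece (H := HT F₀ m) h34.le h4n hTo hyi₃S hi₃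
  have hi₄ : ys i₄ ∈ HR F₀ m ∨ i₄ = n := by
    rcases lt_or_eq_of_le h4n with h | h
    · left
      obtain ⟨q, hq⟩ := hW i₄ h
      exact (hR₂ i₄ le_rfl h) ((hq _ (Walk.start_mem_support q)).2.elim Or.inl
        (fun h' ↦ Or.inr (h' ▸ (hL i₄ h).1)))
    · exact Or.inr h
  have hyi₄S : ys i₄ ∈ S := hySall i₄ (by omega)
  -- closing walk from `ys n`
  have hyn : ys n ∈ bL D n c k (n - 1) := by
    have := (hL (n - 1) (by omega)).1; rwa [Nat.sub_add_cancel hn] at this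
  obtain ⟨q, hq⟩ := hclose (ys n) hyn
  obtain ⟨W₅, hW₅⟩ : ∃ p : (zdGraph 2).Walk (ys i₄) x,
      ∀ z ∈ p.support, z ∈ K ∧ z ∈ WeakBeurling.sqBox F₀ N ∧ z ∈ HR F₀ m := by
    rcases hi₄ with hi₄ | hi₄
    · obtain ⟨p, hp⟩ := piece (H := HR F₀ m) h4n le_rfl hR₂ hyi₄S hi₄
      refine ⟨p.append q, fun z hz ↦ ?_⟩
      rw [Walk.mem_support_append_iff] at hz
      exact hz.elim (hp z) (hq z)
    · subst hi₄; exact ⟨q, hq⟩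
  -- the circuit, based at `ys i₃`
  refine false_of_circuit (N := N) hK hF₀ hm W₄ (W₅.append (W₁.copy h0 rfl)) W₂ W₃
    (fun z hz ↦ ⟨(hW₄ z hz).1, (hW₄ z hz).2.1, (hW₄ z hz).2.2⟩) (fun z hz ↦ ?_)
    (fun z hz ↦ ⟨(hW₂ z hz).1, (hW₂ z hz).2.1, (hW₂ z hz).2.2⟩)
    (fun z hz ↦ ⟨(hW₃ z hz).1, (hW₃ z hz).2.1, (hW₃ z hz).2.2⟩) ?_ ?_
  · rw [Walk.mem_support_append_iff, Walk.support_copy] at hz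
    rcases hz with hz | hz
    · exact ⟨(hW₅ z hz).1, (hW₅ z hz).2.1, (hW₅ z hz).2.2⟩
    · exact ⟨(hW₁ z hz).1, (hW₁ z hz).2.1, (hW₁ z hz).2.2⟩
  · -- `ys i₄` is high: end of the top piece
    have := (hW₄ _ (Walk.end_mem_support W₄)).2.2
    exact this
  · exact hi₁

/-- **The killed chain of a counter-clockwise circuit design vanishes.** Design `D` of length `n` with
`L i ⊆ T (i+1)`, whose steps `[0, i₁)` (approach and lower part of the ascent), `[i₁, i₂)`,
`[i₂, i₃)`, `[i₃, i₄)`, `[i₄, n)` lie (rectangles, landing sets, all inside the box of radius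
`N` about `F₀`) respectively right of, above, left of, below, and right of the box of radius
`m ≥ 1` about the face `F₀ ∉ K` (`K ⊇ S` hole-free), with `i₁ < i₂`, `i₃ < i₄`, and such that
every final landing point is joined back to the start `x` by a walk in `K`, right of the small
box and inside the big one. Then `N_n x = 0`: the walk killed on `Sᶜ` cannot perform the whole
maneuver (the reversed circuit is clockwise). [folklore] -/
theorem chainN_eq_zero_of_ccw (hK : HoleFree K) (hSK : S ⊆ K) (hF₀ : F₀ ∉ K) (hm : 1 ≤ m)
    (hLT : ∀ i, i + 1 < n → (D i).L (c i) k ⊆ (D (i + 1)).T (c (i + 1)) k)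
    {i₁ i₂ i₃ i₄ : ℕ} (h12 : i₁ < i₂) (h23 : i₂ ≤ i₃) (h34 : i₃ < i₄) (h4n : i₄ ≤ n)
    (hbox : ∀ i < n, bU D n c k i ∪ bL D n c k i ⊆ WeakBeurling.sqBox F₀ N)
    (hR₁ : ∀ i < i₁, bU D n c k i ∪ bL D n c k i ⊆ HR F₀ m)
    (hTo : ∀ i, i₁ ≤ i → i < i₂ → bU D n c k i ∪ bL D n c k i ⊆ HT F₀ m)
    (hLe : ∀ i, i₂ ≤ i → i < i₃ → bU D n c k i ∪ bL D n c k i ⊆ HL F₀ m)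
    (hBo : ∀ i, i₃ ≤ i → i < i₄ → bU D n c k i ∪ bL D n c k i ⊆ HB F₀ m)
    (hR₂ : ∀ i, i₄ ≤ i → i < n → bU D n c k i ∪ bL D n c k i ⊆ HR F₀ m)
    {x : Site 2} (hx : x ∈ bT D n c k 0) (hxR : x ∈ HR F₀ m) (hxN : x ∈ WeakBeurling.sqBox F₀ N)
    (hclose : ∀ y ∈ bL D n c k (n - 1), ∃ q : (zdGraph 2).Walk y x,
      ∀ z ∈ q.support, z ∈ K ∧ z ∈ WeakBeurling.sqBox F₀ N ∧ z ∈ HR F₀ m) :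
    chainN (bU D n c k) (bL D n c k) S n n x = 0 := by
  classical
  have hn : 0 < n := by omega
  by_cases hxS : x ∈ S
  swap
  · -- off `S` the killed chain vanishes at once
    have e : n - 1 + 1 = n := Nat.sub_add_cancel hn
    have : chainN (bU D n c k) (bL D n c k) S n n x = chainN (bU D n c k) (bL D n c k) S n (n - 1 + 1) x := by
      rw [e]
    rw [this]
    show harmExt (bU D n c k (n - 1 - (n - 1)) ∩ S) _ x = 0
    rw [harmExt_of_not_mem ((bU_finite D n c k _).subset inter_subset_left) _ (fun h ↦ hxS h.2)]
    simp [hxS]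
  by_contra hne
  have hpos : 0 < chainN (bU D n c k) (bL D n c k) S n n x :=
    lt_of_le_of_ne (chainN_mem_Icc (bU_finite D n c k) n x).1 (Ne.symm hne)
  obtain ⟨ys, h0, hL, hW⟩ := exists_landings_of_chainN_pos hLT hx hxS hpos
  have hyS : ∀ i < n, ys (i + 1) ∈ S := fun i hi ↦ (hL i hi).2
  have hySK : ∀ i ≤ n, ys i ∈ K := by
    intro i hi
    rcases Nat.eq_zero_or_pos i with rfl | hi0
    · rw [h0]; exact hSK hxS
    · have := hyS (i - 1) (by omega); rw [Nat.sub_add_cancel hi0] at this; exact hSK this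
  -- membership of landing points in the regions of their steps
  have hyU : ∀ {H : Set (Site 2)} {i : ℕ}, i < n → bU D n c k i ∪ bL D n c k i ⊆ H → ys (i + 1) ∈ H :=
    fun hi h ↦ h (Or.inr (hL _ hi).1)
  have piece : ∀ {H : Set (Site 2)} {a b : ℕ}, a ≤ b → b ≤ n →
      (∀ i, a ≤ i → i < b → bU D n c k i ∪ bL D n c k i ⊆ H) → ys a ∈ S → ys a ∈ H →
      ∃ p : (zdGraph 2).Walk (ys a) (ys b), ∀ z ∈ p.support, z ∈ K ∧ z ∈ WeakBeurling.sqBox F₀ N ∧ z ∈ H := by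
    intro H a b hab hbn hH haS haH
    have haN : ys a ∈ WeakBeurling.sqBox F₀ N := by
      rcases Nat.eq_zero_or_pos a with h | ha0
      · rw [h, h0]; exact hxN
      · have := hyU (i := a - 1) (by omega) (hbox (a - 1) (by omega))
        rwa [Nat.sub_add_cancel ha0] at this
    obtain ⟨p, hp⟩ := exists_walk_Ico (D := D) (n := n) (c := c) (k := k) hW hab hbn
      (H := H ∩ WeakBeurling.sqBox F₀ N)
      (fun i hai hib ↦ ⟨subset_inter (subset_union_left.trans (hH i hai hib))
        (subset_union_left.trans (hbox i (by omega))),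
        ⟨hyU (by omega) (hH i hai hib), hyU (by omega) (hbox i (by omega))⟩⟩) haS ⟨haH, haN⟩
    exact ⟨p, fun z hz ↦ ⟨hSK (hp z hz).1, (hp z hz).2.2, (hp z hz).2.1⟩⟩
  have hx0S : ys 0 ∈ S := by rw [h0]; exact hxS
  -- the five pieces
  obtain ⟨W₁, hW₁⟩ := piece (H := HR F₀ m) (a := 0) (b := i₁) (by omega) (by omega)
    (fun i _ hi ↦ hR₁ i hi) hx0S (by rw [h0]; exact hxR)
  have hi₁ : ys i₁ ∈ HT F₀ m := by
    obtain ⟨q, hq⟩ := hW i₁ (by omega)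
    exact (hTo i₁ le_rfl h12) ((hq _ (Walk.start_mem_support q)).2.elim Or.inl
      (fun h ↦ Or.inr (h ▸ (hL i₁ (by omega)).1)))
  have hySall : ∀ i ≤ n, ys i ∈ S := by
    intro i hi
    rcases Nat.eq_zero_or_pos i with h | hi0
    · rw [h]; exact hx0S
    · have := hyS (i - 1) (by omega); rwa [Nat.sub_add_cancel hi0] at this
  obtain ⟨W₂, hW₂⟩ := piece (H := HT F₀ m) (a := i₁) (b := i₂) h12.le (by omega) hTo
    (hySall i₁ (by omega)) hi₁
  have hi₂ : ys i₂ ∈ HL F₀ m ∨ i₂ = i₃ := by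
    rcases lt_or_eq_of_le h23 with h | h
    · left
      obtain ⟨q, hq⟩ := hW i₂ (by omega)
      exact (hLe i₂ le_rfl h) ((hq _ (Walk.start_mem_support q)).2.elim Or.inl
        (fun h' ↦ Or.inr (h' ▸ (hL i₂ (by omega)).1)))
    · exact Or.inr h
  have hi₃ : ys i₃ ∈ HB F₀ m := by
    obtain ⟨q, hq⟩ := hW i₃ (by omega)
    exact (hBo i₃ le_rfl h34) ((hq _ (Walk.start_mem_support q)).2.elim Or.inl
      (fun h ↦ Or.inr (h ▸ (hL i₃ (by omega)).1)))
  have hyi₂S : ys i₂ ∈ S := hySall i₂ (by omega)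
  obtain ⟨W₃, hW₃⟩ : ∃ p : (zdGraph 2).Walk (ys i₂) (ys i₃),
      ∀ z ∈ p.support, z ∈ K ∧ z ∈ WeakBeurling.sqBox F₀ N ∧ z ∈ HL F₀ m := by
    rcases hi₂ with hi₂ | hi₂
    · exact piece (H := HL F₀ m) h23 (by omega) hLe hyi₂S hi₂
    · subst hi₂
      refine ⟨Walk.nil, fun z hz ↦ ?_⟩
      rw [Walk.support_nil, List.mem_singleton] at hz
      subst hz
      exfalso
      have ht : ys i₂ ∈ HT F₀ m := by
        have := hyU (i := i₂ - 1) (by omega) (hTo (i₂ - 1) (by omega) (by omega))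
        rwa [Nat.sub_add_cancel (by omega : 0 < i₂)] at this
      simp only [HB, HT, Set.mem_setOf_eq] at ht hi₃
      omega
  have hyi₃S : ys i₃ ∈ S := hySall i₃ (by omega)
  obtain ⟨W₄, hW₄⟩ := piece (H := HB F₀ m) h34.le h4n hBo hyi₃S hi₃
  have hi₄ : ys i₄ ∈ HR F₀ m ∨ i₄ = n := by
    rcases lt_or_eq_of_le h4n with h | h
    · left
      obtain ⟨q, hq⟩ := hW i₄ h
      exact (hR₂ i₄ le_rfl h) ((hq _ (Walk.start_mem_support q)).2.elim Or.inl
        (fun h' ↦ Or.inr (h' ▸ (hL i₄ h).1)))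
    · exact Or.inr h
  have hyi₄S : ys i₄ ∈ S := hySall i₄ (by omega)
  -- closing walk from `ys n`
  have hyn : ys n ∈ bL D n c k (n - 1) := by
    have := (hL (n - 1) (by omega)).1; rwa [Nat.sub_add_cancel hn] at this
  obtain ⟨q, hq⟩ := hclose (ys n) hyn
  obtain ⟨W₅, hW₅⟩ : ∃ p : (zdGraph 2).Walk (ys i₄) x,
      ∀ z ∈ p.support, z ∈ K ∧ z ∈ WeakBeurling.sqBox F₀ N ∧ z ∈ HR F₀ m := by
    rcases hi₄ with hi₄ | hi₄
    · obtain ⟨p, hp⟩ := piece (H := HR F₀ m) h4n le_rfl hR₂ hyi₄S hi₄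
      refine ⟨p.append q, fun z hz ↦ ?_⟩
      rw [Walk.mem_support_append_iff] at hz
      exact hz.elim (hp z) (hq z)
    · subst hi₄; exact ⟨q, hq⟩
  -- the reversed circuit (clockwise), based at `ys i₂`
  refine false_of_circuit (N := N) hK hF₀ hm W₂.reverse (((W₁.copy h0 rfl).reverse.append W₅.reverse))
    W₄.reverse W₃.reverse (fun z hz ↦ ?_) (fun z hz ↦ ?_) (fun z hz ↦ ?_) (fun z hz ↦ ?_) hi₁ ?_
  · rw [Walk.support_reverse, List.mem_reverse] at hz
    exact ⟨(hW₂ z hz).1, (hW₂ z hz).2.1, (hW₂ z hz).2.2⟩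
  · rw [Walk.mem_support_append_iff, Walk.support_reverse, List.mem_reverse, Walk.support_copy,
      Walk.support_reverse, List.mem_reverse] at hz
    rcases hz with hz | hz
    · exact ⟨(hW₁ z hz).1, (hW₁ z hz).2.1, (hW₁ z hz).2.2⟩
    · exact ⟨(hW₅ z hz).1, (hW₅ z hz).2.1, (hW₅ z hz).2.2⟩
  · rw [Walk.support_reverse, List.mem_reverse] at hz
    exact ⟨(hW₄ z hz).1, (hW₄ z hz).2.1, (hW₄ z hz).2.2⟩
  · rw [Walk.support_reverse, List.mem_reverse] at hz
    exact ⟨(hW₃ z hz).1, (hW₃ z hz).2.1, (hW₃ z hz).2.2⟩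
  · -- `ys i₄` is low: end of the bottom piece
    exact (hW₄ _ (Walk.end_mem_support W₄)).2.2

end Kill

end BoxChain

end Literature.Probability.LatticeModels
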